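import Summits.Ventures.HodgeRepro2.T5NormQuotientMk
import Summits.Ventures.HodgeRepro2.T5EvenValuationNorm
import Summits.Ventures.HodgeRepro2.T5InertIsotropyOfNormUnits

/-!
# The norm theorem for units of an unramified quadratic extension on a henselian base
(Tier-5 support, N3)

**`N_{E/F}(𝒪_E^×) = 𝒪_F^×`** (Serre, Local Fields, V §2 Prop. 3) in kernel form: `R₀` a DVR that is
HENSELIAN (`HenselianLocalRing R₀` — Mathlib's class; p4's `T5AdicCompletionHenselian` provides it
for `O_Kv`) with finite residue field, `E/F` quadratic with Galois conjugation `σ`,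
`𝒪_E := integralClosure R₀ E` local with `𝔭 𝒪_E = 𝔭_E`: every unit `u` of `R₀` is `σ z · z` for some
`z ∈ 𝒪_E` (`exists_isInteger_conj_mul_eq_unit`). Consequently the hypothesis `hnorm` of
`T5InertIsotropyOfNormUnits.exists_isotropic_of_norm_surjective` is discharged: every hermitian
`3 × 3` matrix with unit determinant over `E` is ISOTROPIC (`exists_isotropic_of_henselian`) — the
«isotropy of `V_v` (printed)» cell of CHECK-N3 closed on a henselian base.

Proof. `T5NormQuotientMk` gives `y₁ ∈ 𝒪_E` with `y₁ · σ y₁ = n ∈ R₀`, `n ≡ u mod 𝔭` (so `n` is a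
unit); `T5UnramifiedTraceOne` gives `c ∈ 𝒪_E` with `c + σ c = 1`; put `θ := y₁ c / n`, so that
`θ · σ y₁ = c`, `y₁ · σ θ = σ c` and `θ · σ θ = m ∈ R₀`. Then for `a ∈ R₀`
`N(y₁ + a θ) = n + a + a² m`, and `N(y₁ + aθ) = u` is the quadratic `m a² + a + (n − u) = 0`, whose
monic companion `h(Y) = Y² + Y + m(n − u)` has the simple residue root `0` (`h(0) = m(n−u) ∈ 𝔭`,
`h'(0) = 1`); Hensel's lemma (`HenselianLocalRing.is_henselian`) gives `Y ∈ 𝔭` with `h(Y) = 0`, and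
`a := −(n − u)/(1 + Y)` satisfies `a m = Y` and `N(y₁ + a θ) = u`. No L-value anywhere (README §8(d):
NO).
-/

namespace Summit.Ventures.HodgeRepro2.T5NormUnitsHensel

open IsLocalRing Polynomial

section Hensel

variable {R₀ : Type*} [CommRing R₀] [HenselianLocalRing R₀]

/-- `1 + Y` is a unit when `Y` lies in the maximal ideal. -/
theorem isUnit_one_add_of_mem {Y : R₀} (hY : Y ∈ maximalIdeal R₀) : IsUnit (1 + Y) := by
  have h := IsLocalRing.isUnit_one_sub_self_of_mem_nonunits (-Y)
    (by rw [← IsLocalRing.mem_maximalIdeal]; exact (maximalIdeal R₀).neg_mem hY)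
  rwa [sub_neg_eq_add] at h

/-- An element congruent to a unit modulo the maximal ideal is a unit. -/
theorem isUnit_of_sub_mem {n : R₀} (u : R₀ˣ) (h : n - u ∈ maximalIdeal R₀) : IsUnit n := by
  have h1 : IsUnit (1 + (↑u⁻¹ : R₀) * (n - u)) :=
    isUnit_one_add_of_mem ((maximalIdeal R₀).mul_mem_left _ h)
  have h2 : n = (u : R₀) * (1 + (↑u⁻¹ : R₀) * (n - u)) := by
    rw [mul_add, mul_one, ← mul_assoc, Units.mul_inv, one_mul, add_sub_cancel]
  rw [h2]
  exact u.isUnit.mul h1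

/-- **Hensel's lemma for the quadratic `m a² + a + k = 0` with `k ∈ 𝔭`**: it has a root `a ∈ R₀`
(the monic companion `Y² + Y + m k` has the simple residue root `0`; `a = −k/(1 + Y)`). -/
theorem exists_root_quadratic {m k : R₀} (hk : k ∈ maximalIdeal R₀) :
    ∃ a : R₀, m * a ^ 2 + a + k = 0 := by
  set h : R₀[X] := X ^ 2 + (X + C (m * k)) with hh
  have hmonic : h.Monic := by
    refine Polynomial.monic_X_pow_add ?_
    rw [Polynomial.degree_X_add_C]
    exact Nat.one_lt_ofNat
  have h0 : h.eval 0 ∈ maximalIdeal R₀ := by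
    simp only [hh, eval_add, eval_pow, eval_X, eval_C]
    simpa using (maximalIdeal R₀).mul_mem_left m hk
  have h1 : IsUnit (h.derivative.eval 0) := by
    simp only [hh, derivative_add, derivative_X_pow, derivative_X, derivative_C, eval_add,
      eval_mul, eval_C, eval_pow, eval_X, eval_one]
    simp
  obtain ⟨Y, hY, hY0⟩ := HenselianLocalRing.is_henselian h hmonic 0 h0 h1
  rw [sub_zero] at hY0
  have hYeq : Y ^ 2 + Y + m * k = 0 := by
    have := hY
    simp only [hh, IsRoot, eval_add, eval_pow, eval_X, eval_C] at this
    linear_combination this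
  obtain ⟨v, hv⟩ := isUnit_one_add_of_mem hY0
  refine ⟨-k * (↑v⁻¹ : R₀), ?_⟩
  have hav : -k * (↑v⁻¹ : R₀) * (1 + Y) = -k := by
    rw [← hv, mul_assoc, Units.inv_mul, mul_one]
  -- `a m = Y`: `(a m − Y)(1 + Y) = m · a(1+Y) − (Y + Y²) = −m k − Y − Y² = 0`
  have hamY : -k * (↑v⁻¹ : R₀) * m - Y = 0 := by
    have h3 : (-k * (↑v⁻¹ : R₀) * m - Y) * (1 + Y) = 0 := by
      linear_combination m * hav - hYeq
    rw [← hv] at h3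
    exact (v.isUnit.mul_left_eq_zero).mp h3
  linear_combination hav + (-k * (↑v⁻¹ : R₀)) * hamY

end Hensel

section Inert

variable {R₀ F E : Type*} [CommRing R₀] [IsDomain R₀] [IsDiscreteValuationRing R₀]
  [HenselianLocalRing R₀] [Field F] [Field E] [Algebra R₀ F] [IsFractionRing R₀ F] [Algebra F E]
  [Algebra R₀ E] [IsScalarTower R₀ F E] [FiniteDimensional F E] [Algebra.IsSeparable F E]
  [IsLocalRing (integralClosure R₀ E)] [Finite (ResidueField R₀)]

/-- **The norm theorem for units on a henselian base.** Every unit `u` of `R₀` is `σ z · z` for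
some `z ∈ 𝒪_E`. -/
theorem exists_isInteger_conj_mul_eq_unit (h2 : Module.finrank F E = 2) (σ : E ≃ₐ[F] E)
    (hσ : σ ≠ 1)
    (hunr : Ideal.map (algebraMap R₀ (integralClosure R₀ E)) (maximalIdeal R₀) =
      maximalIdeal (integralClosure R₀ E)) (u : R₀ˣ) :
    ∃ z : E, IsLocalization.IsInteger (integralClosure R₀ E) z ∧ σ z * z = algebraMap R₀ E u := by
  haveI : Algebra.IsQuadraticExtension F E := ⟨h2⟩
  haveI : IsGalois F E := inferInstance
  letI := T5StarOfInvolution.starRingOfQuadratic h2 σ hσ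
  have hτ := T5QuadraticAutomorphism.apply_apply h2 σ hσ
  have hstar : ∀ z : E, star z = σ z := fun z => T5StarOfInvolution.star_eq σ.toRingEquiv hτ z
  have hF : ∀ z : E, star z = z → z ∈ Set.range (algebraMap F E) :=
    fun z hz => (T5StarOfInvolution.star_eq_self_iff_mem_range h2 σ hσ z).mp hz
  -- the residue step: `y₁ ∈ 𝒪_E` with `y₁ σ y₁ = n`, `n − u ∈ 𝔭`
  obtain ⟨y₁, n, hy₁, hy₁n, hnu⟩ :=
    T5NormQuotientMk.exists_isInteger_mul_conj_sub_mem (F := F) h2 σ hσ hunr (u : R₀)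
  obtain ⟨nu, hnu'⟩ := isUnit_of_sub_mem u hnu
  have hn0 : algebraMap R₀ E n ≠ 0 := by
    rw [← hnu']
    exact T5GaloisCartanThree.algebraMap_unit_ne_zero (F := F) nu
  -- the trace-one element: `c ∈ 𝒪_E` with `c + σ c = 1`
  obtain ⟨c, hc, hc1⟩ := T5UnramifiedTraceOne.trace_decomposition_of_unramified R₀ F E h2 σ hσ hunr
    1 ⟨1, map_one _⟩ (star_one E)
  rw [hstar] at hc1
  -- `θ := y₁ c / n`
  obtain ⟨θ, hθ⟩ : ∃ θ : E, θ = y₁ * c * (algebraMap R₀ E n)⁻¹ := ⟨_, rfl⟩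
  have hθint : IsLocalization.IsInteger (integralClosure R₀ E) θ := by
    rw [hθ]
    refine IsLocalization.isInteger_mul (IsLocalization.isInteger_mul hy₁ hc) ?_
    rw [← hnu', ← map_units_inv]
    exact T5GaloisCartanThree.isInteger_algebraMap _
  have hσn : σ (algebraMap R₀ E n) = algebraMap R₀ E n := T5EvenValuationNorm.algEquiv_algebraMap σ n
  have hθσ : θ * σ y₁ = c := by
    rw [hθ]
    field_simp
    linear_combination c * hy₁n
  have hy₁σθ : y₁ * σ θ = σ c := by
    rw [hθ, map_mul, map_mul, map_inv₀, hσn]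
    field_simp
    linear_combination σ c * hy₁n
  -- `m := θ σ θ ∈ R₀`
  have hm_fix : star (θ * σ θ) = θ * σ θ := by rw [hstar, map_mul, hτ, mul_comm]
  have hm_int : IsLocalization.IsInteger (integralClosure R₀ E) (θ * σ θ) :=
    IsLocalization.isInteger_mul hθint
      (by rw [← hstar]; exact T5StarOfInvolution.isInteger_integralClosure_star σ hτ θ hθint)
  obtain ⟨m, hm⟩ := T5SelfDualLatticeDet.exists_algebraMap_eq_of_star_eq_of_isInteger hF hm_fix hm_int
  -- `N(y₁ + a θ) = n + a + a² m`
  have hnorm : ∀ a : R₀, σ (y₁ + algebraMap R₀ E a * θ) * (y₁ + algebraMap R₀ E a * θ) =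
      algebraMap R₀ E (n + a + m * a ^ 2) := by
    intro a
    rw [map_add, map_mul, T5EvenValuationNorm.algEquiv_algebraMap, map_add, map_add, map_mul,
      map_pow]
    linear_combination hy₁n + (algebraMap R₀ E a) * (hθσ + hy₁σθ + hc1) -
      (algebraMap R₀ E a) ^ 2 * hm
  -- Hensel on `m a² + a + (n − u) = 0`
  obtain ⟨a, ha⟩ := exists_root_quadratic (m := m) hnu
  refine ⟨y₁ + algebraMap R₀ E a * θ,
    IsLocalization.isInteger_add hy₁
      (IsLocalization.isInteger_mul (T5GaloisCartanThree.isInteger_algebraMap a) hθint), ?_⟩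
  rw [hnorm a]
  congr 1
  linear_combination ha

/-- **Isotropy of hermitian 3-spaces at an inert place of a henselian base.** The `hnorm`
hypothesis of `T5InertIsotropyOfNormUnits.exists_isotropic_of_norm_surjective` discharged: every
hermitian `3 × 3` matrix `H` over `E` with `IsUnit H.det` has a non-zero isotropic vector. -/
theorem exists_isotropic_of_henselian (h2 : Module.finrank F E = 2) (σ : E ≃ₐ[F] E) (hσ : σ ≠ 1)
    (hunr : Ideal.map (algebraMap R₀ (integralClosure R₀ E)) (maximalIdeal R₀) =
      maximalIdeal (integralClosure R₀ E))
    {ϖ : R₀} (hϖ : Irreducible ϖ) {H : Matrix (Fin 3) (Fin 3) E}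
    (hH : letI := T5StarOfInvolution.starRingOfQuadratic h2 σ hσ; H.IsHermitian)
    (hdet : IsUnit H.det) :
    letI := T5StarOfInvolution.starRingOfQuadratic h2 σ hσ
    ∃ x : Fin 3 → E, x ≠ 0 ∧ T5UnitaryGroupIsometry.sesqForm H x x = 0 :=
  T5InertIsotropyOfNormUnits.exists_isotropic_of_norm_surjective h2 σ hσ hunr hϖ
    (fun b => by
      obtain ⟨z, -, hz⟩ := exists_isInteger_conj_mul_eq_unit (F := F) h2 σ hσ hunr b
      exact ⟨z, hz⟩) hH hdet

end Inert

end Summit.Ventures.HodgeRepro2.T5NormUnitsHensel
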